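import Summits.KontsevichZagierPeriods.KontsevichZagierPeriods.Theorems.FermatIsogenyDeepWordSectorC
import Summits.KontsevichZagierPeriods.KontsevichZagierPeriods.Theorems.FermatIsogenyDeepWordSectorProdRung

/-! # The ladder rungs `ProdRung 3`, `ProdRung 4` BY NAME (hypothesis-free) and `ProdRung 6` modulo `h6`

decomp-kz census-1 g10 (landing seat), per critic g7 l.1416: the LEVEL-`N` rungs of `Cruxes/BetaProductSector/Ladder.lean`
(`ProdRung N` = crux 3898 `BetaProductSector` VERBATIM with the eight exponents in `(1/N)ℤ`; the registered line
`Cruxes/BetaProductSector/Lines/ProdRungFour.lean` has `ProdRungFour := ProdRung 4` with the SAME text, so `prodRung_four` below is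
its crux decl up to `Iff.rfl`) follow from lens-5 g22's hypothesis-free boxes `betaWordSectorLevel_three/_four` (Chudnovsky
discharged from the tree) through the level bridge `prodRungAt_of_level` (…DeepWordSectorProdRung).  The statements are spelled out
(not imported from the `Cruxes/` files, which carry `sorry` stubs / a farm-unbuilt import).  --supports stmt-KontsevichZagierPeriods-3898. -/

noncomputable section

namespace Summit.KontsevichZagierPeriods.FermatIsogeny.DeepTargets

open Literature.NumberTheory.Transcendental MeasureTheory

/-- **RUNG `ProdRung 3` of the 3898 ladder, PROVED** (verbatim `Ladder.ProdRung 3`: Conjecture 1 for two-letter Beta products with all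
eight exponents in `⅓ℤ_{>0}`): from `betaWordSectorLevel_three 2` (Dirichlet move + Chudnovsky `Γ(⅓)` from the tree) and the level bridge. -/
theorem prodRung_three :
    ∀ (a b e d a' b' e' d' : ℚ) (q : ℝ), 0 < a → 0 < b → 0 < e → 0 < d → 0 < a' → 0 < b' → 0 < e' → 0 < d' →
    IsAlgebraic ℚ q →
    (∃ m : ℤ, a = m / 3) → (∃ m : ℤ, b = m / 3) → (∃ m : ℤ, e = m / 3) → (∃ m : ℤ, d = m / 3) →
    (∃ m : ℤ, a' = m / 3) → (∃ m : ℤ, b' = m / 3) → (∃ m : ℤ, e' = m / 3) → (∃ m : ℤ, d' = m / 3) →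
    ∀ (r r' : KZ.IntegralRep 2), r.domain = {x | ∀ i, x i ∈ Set.Ioo (0:ℝ) 1} →
    Set.EqOn r.integrand (fun x => (x 0) ^ ((a:ℝ) - 1) * (1 - x 0) ^ ((b:ℝ) - 1) * (x 1) ^ ((e:ℝ) - 1) *
      (1 - x 1) ^ ((d:ℝ) - 1)) r.domain →
    r'.domain = {x | ∀ i, x i ∈ Set.Ioo (0:ℝ) 1} →
    Set.EqOn r'.integrand (fun x => q * (x 0) ^ ((a':ℝ) - 1) * (1 - x 0) ^ ((b':ℝ) - 1) * (x 1) ^ ((e':ℝ) - 1) *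
      (1 - x 1) ^ ((d':ℝ) - 1)) r'.domain →
    r.value = r'.value → KZ.Equivalent r r'
  :=
  prodRungAt_of_level (by norm_num) (betaWordSectorLevel_three 2)

/-- **RUNG `ProdRung 4` = the registered line decl `ProdRungFour`, PROVED** (verbatim `Ladder.ProdRung 4`: Conjecture 1 for two-letter
Beta products with all eight exponents in `¼ℤ_{>0}`): from `betaWordSectorLevel_four 2` (Legendre duplication chains + Chudnovsky `Γ(¼)`
from the tree theorem `algebraicIndependent_real_pi_gamma_one_quarter`) and the level bridge.  This is the by-name content of the line's two
stubs `stub_quarterAtomValues` / `stub_quarterProductSeparation` combined (critic g7 l.1416 VALUE FLAG). -/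
theorem prodRung_four :
    ∀ (a b e d a' b' e' d' : ℚ) (q : ℝ), 0 < a → 0 < b → 0 < e → 0 < d → 0 < a' → 0 < b' → 0 < e' → 0 < d' →
    IsAlgebraic ℚ q →
    (∃ m : ℤ, a = m / 4) → (∃ m : ℤ, b = m / 4) → (∃ m : ℤ, e = m / 4) → (∃ m : ℤ, d = m / 4) →
    (∃ m : ℤ, a' = m / 4) → (∃ m : ℤ, b' = m / 4) → (∃ m : ℤ, e' = m / 4) → (∃ m : ℤ, d' = m / 4) →
    ∀ (r r' : KZ.IntegralRep 2), r.domain = {x | ∀ i, x i ∈ Set.Ioo (0:ℝ) 1} →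
    Set.EqOn r.integrand (fun x => (x 0) ^ ((a:ℝ) - 1) * (1 - x 0) ^ ((b:ℝ) - 1) * (x 1) ^ ((e:ℝ) - 1) *
      (1 - x 1) ^ ((d:ℝ) - 1)) r.domain →
    r'.domain = {x | ∀ i, x i ∈ Set.Ioo (0:ℝ) 1} →
    Set.EqOn r'.integrand (fun x => q * (x 0) ^ ((a':ℝ) - 1) * (1 - x 0) ^ ((b':ℝ) - 1) * (x 1) ^ ((e':ℝ) - 1) *
      (1 - x 1) ^ ((d':ℝ) - 1)) r'.domain →
    r.value = r'.value → KZ.Equivalent r r'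
  :=
  prodRungAt_of_level (by norm_num) (betaWordSectorLevel_four 2)

/-- **RUNG `ProdRung 6` modulo the route's linear rung** (`h6 : BetaLinearSixths` = VERBATIM the statement of the tree theorem
`BetaLinearSector.SixthsMax.betaLinearSector_sixths`, module farm-unbuilt — OPS-1 addendum #3): from `betaWordSectorLevel_six_of_linear`. -/
theorem prodRung_six_of_linear (h6 : BetaLinearSixths) :
    ∀ (a b e d a' b' e' d' : ℚ) (q : ℝ), 0 < a → 0 < b → 0 < e → 0 < d → 0 < a' → 0 < b' → 0 < e' → 0 < d' →
    IsAlgebraic ℚ q →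
    (∃ m : ℤ, a = m / 6) → (∃ m : ℤ, b = m / 6) → (∃ m : ℤ, e = m / 6) → (∃ m : ℤ, d = m / 6) →
    (∃ m : ℤ, a' = m / 6) → (∃ m : ℤ, b' = m / 6) → (∃ m : ℤ, e' = m / 6) → (∃ m : ℤ, d' = m / 6) →
    ∀ (r r' : KZ.IntegralRep 2), r.domain = {x | ∀ i, x i ∈ Set.Ioo (0:ℝ) 1} →
    Set.EqOn r.integrand (fun x => (x 0) ^ ((a:ℝ) - 1) * (1 - x 0) ^ ((b:ℝ) - 1) * (x 1) ^ ((e:ℝ) - 1) *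
      (1 - x 1) ^ ((d:ℝ) - 1)) r.domain →
    r'.domain = {x | ∀ i, x i ∈ Set.Ioo (0:ℝ) 1} →
    Set.EqOn r'.integrand (fun x => q * (x 0) ^ ((a':ℝ) - 1) * (1 - x 0) ^ ((b':ℝ) - 1) * (x 1) ^ ((e':ℝ) - 1) *
      (1 - x 1) ^ ((d':ℝ) - 1)) r'.domain →
    r.value = r'.value → KZ.Equivalent r r'
  :=
  prodRungAt_of_level (by norm_num) (betaWordSectorLevel_six_of_linear h6 2)

end Summit.KontsevichZagierPeriods.FermatIsogeny.DeepTargets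

end
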